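/-
  Summits/AtomisticToContinuum/Crystallization/Theorems/OverbindingBudgetAffineFarCoreIdentification.lean

  residual stmt-AtomisticToContinuum-31280 · slot Z · leaf LAB₁′ `ShelteredShellLabelling'` (leaf list v14′, critic rows 890/899; engine
  LAB₁′ ⟸ R_aff′ ∧ BBI₀ ∧ CORE): tool-box for CORE `CoreRechart (1/25)`, part 2 — the STEP LEMMA and the MINIMAL-COUNTEREXAMPLE IDENTIFICATION
  THEOREM: two distorted copies `Φ_c(𝓛(t))`, `Φ_b(Z)` (`Z` a based isometric image of a stacking) of close-packed stackings that are matched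
  point-to-point to accuracy `ε` inside a region, and whose origin shells are identified by a linear isometry `U` with `Φ_c ≈ Φ_b ∘ U` on a
  frame, are identified by `U` throughout the region (`z = U x` for every matched pair).  decomp-a2c lens-4 «minimal counterexample /
  extremal reduction», generation 58.  Imports C1 `…FarCoreLattice` only.  0 sorry · 0 axiom · no instance · no notation · no option.
-/
import Summits.AtomisticToContinuum.Crystallization.Theorems.OverbindingBudgetAffineFarCoreLattice

/-! # CORE tool-box 2: step lemma and identification by minimal counterexample (PROVED)

Setting.  `X = 𝓛(t) = barlowStacking 1 √(2/3) t` (origin `0`, origin shell `barlowShell (t 0) (−t(−1))`); `Z = basedImage V s p₀ =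
{V (q − p₀) : q ∈ 𝓛(s)}` (`V` a linear isometry, `p₀ ∈ 𝓛(s)`, so `0 ∈ Z` and `Z` is `1`-separated); two linear "charts" `Φ_c = a • B`
(`(22/25)‖v‖ ≤ ‖B v‖ ≤ (28/25)‖v‖`) and `Φ_b` (`μ‖v‖ ≤ ‖Φ_b v‖`); a pair `(x, z)` is MATCHED when `‖Φ_c x − Φ_b z‖ ≤ ε`.
* §1 based images: membership, `0 ∈ Z`, separation, frame-lattice doubles.
* §2 STEP LEMMA: matched pairs `(x,z)`, `(x',z')` with `‖x − x'‖ ≤ 1` have `z − z' = U (x − x')` — `w = (z − z') − U(x − x')` has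
  `‖Φ_b w‖ ≤ 5ε`, so `‖w‖ < 1/6`, and `⟪2w, U e⟫ ∈ (2/3)ℤ` for the origin shell `e` (frame-lattice products), whence `w = 0` (dual gap, C1).
* §3 IDENTIFICATION: if every `x ∈ X` with `‖Φ_c x‖ ≤ ρ` is matched, then every matched pair in that region has `z = U x` — a
  counterexample minimal in `‖B x‖` has an inward contact neighbour (C1 §4) that is matched and identified, and the step lemma transfers.
-/

namespace Summit.AtomisticToContinuum.Crystallization.Theorems.OverbindingBudgetAffineFarSmoothSplit

open scoped BigOperators RealInnerProductSpace
open Literature.MathematicalPhysics.StatisticalMechanics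
open Literature.Geometry.DiscreteGeometry (layerSpacing layerShell hexagonSet holeTriple mem_layerShell_iff hexagonSet_subset_layerShell)

/-! ## §1  Based isometric images of a stacking (PROVED) -/

/-- The based isometric image `{V (q − p₀) : q ∈ 𝓛₁(s)}` of the unit close-packed stacking with word `s`. [this file] -/
def basedImage (V : EuclideanSpace ℝ (Fin 3) →ₗᵢ[ℝ] EuclideanSpace ℝ (Fin 3)) (s : ℤ → ℤ) (p₀ : EuclideanSpace ℝ (Fin 3)) :
    Set (EuclideanSpace ℝ (Fin 3)) :=
  (fun q => V (q - p₀)) '' barlowStacking 1 (Real.sqrt (2 / 3)) s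

/-- Membership in the based image. [this file] -/
theorem mem_basedImage_iff {V : EuclideanSpace ℝ (Fin 3) →ₗᵢ[ℝ] EuclideanSpace ℝ (Fin 3)} {s : ℤ → ℤ} {p₀ z : EuclideanSpace ℝ (Fin 3)} :
    z ∈ basedImage V s p₀ ↔ ∃ q ∈ barlowStacking 1 (Real.sqrt (2 / 3)) s, V (q - p₀) = z := Iff.rfl

/-- Sites of the stacking give points of the based image. [this file] -/
theorem mem_basedImage_of_mem (V : EuclideanSpace ℝ (Fin 3) →ₗᵢ[ℝ] EuclideanSpace ℝ (Fin 3)) {s : ℤ → ℤ} (p₀ : EuclideanSpace ℝ (Fin 3))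
    {q : EuclideanSpace ℝ (Fin 3)} (hq : q ∈ barlowStacking 1 (Real.sqrt (2 / 3)) s) : V (q - p₀) ∈ basedImage V s p₀ := ⟨q, hq, rfl⟩

/-- `0 ∈ Z` when the base point is a site. [this file] -/
theorem zero_mem_basedImage (V : EuclideanSpace ℝ (Fin 3) →ₗᵢ[ℝ] EuclideanSpace ℝ (Fin 3)) {s : ℤ → ℤ} {p₀ : EuclideanSpace ℝ (Fin 3)}
    (hp₀ : p₀ ∈ barlowStacking 1 (Real.sqrt (2 / 3)) s) : (0 : EuclideanSpace ℝ (Fin 3)) ∈ basedImage V s p₀ :=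
  ⟨p₀, hp₀, by simp⟩

/-- The origin is a site of every stacking. [this file] -/
theorem zero_mem_barlowStacking (s : ℤ → ℤ) : (0 : EuclideanSpace ℝ (Fin 3)) ∈ barlowStacking 1 (Real.sqrt (2 / 3)) s :=
  ⟨0, 0, 0, by simp [barlowPos]⟩

/-- Gap of the unit stacking: two sites at distance `< √2` coincide or touch. [BarlowRings] -/
theorem eq_or_dist_eq_one {t : ℤ → ℤ} (ht : IsHaggSeq t) {u w : EuclideanSpace ℝ (Fin 3)}
    (hu : u ∈ barlowStacking 1 (Real.sqrt (2 / 3)) t) (hw : w ∈ barlowStacking 1 (Real.sqrt (2 / 3)) t)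
    (hlt : dist u w < Real.sqrt 2) : u = w ∨ dist u w = 1 :=
  eq_or_dist_eq_of_dist_lt ht one_pos (by rw [Real.sq_sqrt (by norm_num)]; norm_num) hu hw (by simpa using hlt)

/-- Separation of the unit stacking: two sites at distance `< 1` coincide. [this file] -/
theorem eq_of_dist_lt_one {t : ℤ → ℤ} (ht : IsHaggSeq t) {u w : EuclideanSpace ℝ (Fin 3)}
    (hu : u ∈ barlowStacking 1 (Real.sqrt (2 / 3)) t) (hw : w ∈ barlowStacking 1 (Real.sqrt (2 / 3)) t) (hlt : dist u w < 1) : u = w := by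
  have h2 : (1 : ℝ) < Real.sqrt 2 := by
    rw [show (1 : ℝ) = Real.sqrt 1 by simp]; exact Real.sqrt_lt_sqrt (by norm_num) (by norm_num)
  rcases eq_or_dist_eq_one ht hu hw (hlt.trans h2) with h | h
  · exact h
  · exact absurd h hlt.ne

/-- Separation of a based image: two points at distance `< 1` coincide. [this file] -/
theorem basedImage_eq_of_dist_lt_one {V : EuclideanSpace ℝ (Fin 3) →ₗᵢ[ℝ] EuclideanSpace ℝ (Fin 3)} {s : ℤ → ℤ} (hs : IsHaggSeq s)
    {p₀ z z' : EuclideanSpace ℝ (Fin 3)} (hz : z ∈ basedImage V s p₀) (hz' : z' ∈ basedImage V s p₀) (hlt : dist z z' < 1) : z = z' := by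
  obtain ⟨q, hq, rfl⟩ := hz
  obtain ⟨q', hq', rfl⟩ := hz'
  have hd : dist (V (q - p₀)) (V (q' - p₀)) = dist q q' := by
    rw [dist_eq_norm, ← map_sub, V.norm_map, sub_sub_sub_cancel_right, ← dist_eq_norm]
  rw [hd] at hlt
  rw [eq_of_dist_lt_one hs hq hq' hlt]

/-- A nonzero site of the unit stacking has norm `1` or norm `≥ √2`. [BarlowRings] -/
theorem norm_eq_one_or_sqrt_two_le {t : ℤ → ℤ} (ht : IsHaggSeq t) {x : EuclideanSpace ℝ (Fin 3)}
    (hx : x ∈ barlowStacking 1 (Real.sqrt (2 / 3)) t) (hx0 : x ≠ 0) : ‖x‖ = 1 ∨ Real.sqrt 2 ≤ ‖x‖ := by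
  by_cases hlt : ‖x‖ < Real.sqrt 2
  · rcases eq_or_dist_eq_one ht hx (zero_mem_barlowStacking t) (by rwa [dist_zero_right]) with h | h
    · exact absurd h hx0
    · exact Or.inl (by rwa [dist_zero_right] at h)
  · exact Or.inr (not_lt.1 hlt)

/-- Contact neighbours: for a site `p = barlowPos 1 √(2/3) t k i j` and `e ∈ barlowShell (t k) (−t(k−1))`, `p + e` is a site. [BarlowTexturedSet] -/
theorem barlowPos_add_mem_of_mem_barlowShell {t : ℤ → ℤ} (ht : IsHaggSeq t) (k i j : ℤ) {e : EuclideanSpace ℝ (Fin 3)}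
    (he : e ∈ barlowShell (t k : ℝ) (-((t (k - 1) : ℤ) : ℝ))) :
    barlowPos 1 (Real.sqrt (2 / 3)) t k i j + e ∈ barlowStacking 1 (Real.sqrt (2 / 3)) t := by
  have h := touching_barlowStacking_eq_image_barlowShell ht k i j
  have hmem : barlowPos 1 (Real.sqrt (2 / 3)) t k i j + e ∈
      (fun v => barlowPos 1 (Real.sqrt (2 / 3)) t k i j + v) '' barlowShell (t k : ℝ) (-((t (k - 1) : ℤ) : ℝ)) := ⟨e, he, rfl⟩
  rw [← h] at hmem
  exact hmem.1

/-- The origin shell of `𝓛(t)`: `e ∈ barlowShell (t 0) (−t(−1))` is a site. [BarlowTexturedSet] -/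
theorem mem_of_mem_originShell {t : ℤ → ℤ} (ht : IsHaggSeq t) {e : EuclideanSpace ℝ (Fin 3)}
    (he : e ∈ barlowShell (t 0 : ℝ) (-((t (0 - 1) : ℤ) : ℝ))) : e ∈ barlowStacking 1 (Real.sqrt (2 / 3)) t := by
  have h := barlowPos_add_mem_of_mem_barlowShell ht 0 0 0 he
  simpa [barlowPos] using h

/-- Letters of a Hägg word are `±1` (as reals). [HaggStacking] -/
theorem cast_letter_eq {t : ℤ → ℤ} (ht : IsHaggSeq t) (k : ℤ) : (t k : ℝ) = 1 ∨ (t k : ℝ) = -1 := by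
  rcases ht k with h | h
  · left; exact_mod_cast h
  · right; exact_mod_cast h

/-- Negated letters of a Hägg sequence are `±1` (as reals). [this file] -/
theorem neg_cast_letter_eq {t : ℤ → ℤ} (ht : IsHaggSeq t) (k : ℤ) : -((t k : ℤ) : ℝ) = 1 ∨ -((t k : ℤ) : ℝ) = -1 := by
  rcases ht k with h | h
  · right; rw [h]; norm_num
  · left; rw [h]; norm_num

/-! ## §2  The step lemma (PROVED) -/

/-- Products of doubled `Z`-differences with doubled `Z`-points are in `(2/3)ℤ` (the base point is a site). [this file] -/
theorem inner_two_smul_sub_basedImage_mem {V : EuclideanSpace ℝ (Fin 3) →ₗᵢ[ℝ] EuclideanSpace ℝ (Fin 3)} {s : ℤ → ℤ}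
    {p₀ z z' z'' : EuclideanSpace ℝ (Fin 3)} (hp₀ : p₀ ∈ barlowStacking 1 (Real.sqrt (2 / 3)) s) (hz : z ∈ basedImage V s p₀)
    (hz' : z' ∈ basedImage V s p₀) (hz'' : z'' ∈ basedImage V s p₀) :
    ∃ n : ℤ, ⟪(2 : ℝ) • (z - z'), (2 : ℝ) • z''⟫ = 2 / 3 * n := by
  obtain ⟨q, hq, rfl⟩ := hz
  obtain ⟨q', hq', rfl⟩ := hz'
  obtain ⟨q'', hq'', rfl⟩ := hz''
  have h1 : ⟪(2 : ℝ) • (V (q - p₀) - V (q' - p₀)), (2 : ℝ) • V (q'' - p₀)⟫ = ⟪(2 : ℝ) • (q - q'), (2 : ℝ) • (q'' - p₀)⟫ := by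
    rw [← map_sub, sub_sub_sub_cancel_right, ← map_smul, ← map_smul, V.inner_map_map]
  rw [h1]
  exact (isFrameInt_two_smul_sub hq hq').inner_mem (isFrameInt_two_smul_sub hq'' hp₀)

/-- **STEP LEMMA (PROVED).** In the setting of the file docstring: if `U` is a linear isometry carrying the origin shell of `𝓛(t)` into
`Z = basedImage V s p₀` (`p₀` a site) with `‖Φ_c v − Φ_b (U v)‖ ≤ 3ε‖v‖`, `μ‖v‖ ≤ ‖Φ_b v‖` and `30ε < μ`, then two matched pairs
`(x, z)`, `(x', z')` (`‖Φ_c x − Φ_b z‖ ≤ ε`) with `‖x − x'‖ ≤ 1` satisfy `z − z' = U (x − x')`. [this file] -/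
theorem step_eq {t s : ℤ → ℤ} (ht : IsHaggSeq t) {p₀ : EuclideanSpace ℝ (Fin 3)}
    (hp₀ : p₀ ∈ barlowStacking 1 (Real.sqrt (2 / 3)) s) {V : EuclideanSpace ℝ (Fin 3) →ₗᵢ[ℝ] EuclideanSpace ℝ (Fin 3)}
    {Φc Φb : EuclideanSpace ℝ (Fin 3) →ₗ[ℝ] EuclideanSpace ℝ (Fin 3)} {μ ε : ℝ} (hΦb : ∀ v, μ * ‖v‖ ≤ ‖Φb v‖)
    (hε : 30 * ε < μ) (U : EuclideanSpace ℝ (Fin 3) →ₗᵢ[ℝ] EuclideanSpace ℝ (Fin 3)) (hD : ∀ v, ‖Φc v - Φb (U v)‖ ≤ 3 * ε * ‖v‖)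
    (hU : ∀ e ∈ barlowShell (t 0 : ℝ) (-((t (0 - 1) : ℤ) : ℝ)), U e ∈ basedImage V s p₀)
    {x x' z z' : EuclideanSpace ℝ (Fin 3)} (hx : x ∈ barlowStacking 1 (Real.sqrt (2 / 3)) t)
    (hx' : x' ∈ barlowStacking 1 (Real.sqrt (2 / 3)) t) (hz : z ∈ basedImage V s p₀) (hz' : z' ∈ basedImage V s p₀)
    (hm : ‖Φc x - Φb z‖ ≤ ε) (hm' : ‖Φc x' - Φb z'‖ ≤ ε) (hxx' : ‖x - x'‖ ≤ 1) : z - z' = U (x - x') := by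
  set w := (z - z') - U (x - x') with hw
  -- `‖Φ_b w‖ ≤ 5ε`
  have hε0 : 0 ≤ ε := by
    have := (norm_nonneg _).trans hm
    exact this
  have hΦw : ‖Φb w‖ ≤ 5 * ε := by
    have e : Φb w = (Φb z - Φc x) - (Φb z' - Φc x') + (Φc (x - x') - Φb (U (x - x'))) := by
      simp only [hw, map_sub]; abel
    rw [e]
    have h3 : ‖Φc (x - x') - Φb (U (x - x'))‖ ≤ 3 * ε := by
      refine (hD _).trans ?_
      nlinarith [hxx', norm_nonneg (x - x')]
    calc ‖(Φb z - Φc x) - (Φb z' - Φc x') + (Φc (x - x') - Φb (U (x - x')))‖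
        ≤ ‖Φb z - Φc x‖ + ‖Φb z' - Φc x'‖ + ‖Φc (x - x') - Φb (U (x - x'))‖ := by
          exact (norm_add_le _ _).trans (add_le_add (norm_sub_le _ _) le_rfl)
      _ ≤ ε + ε + 3 * ε := by rw [norm_sub_rev (Φb z), norm_sub_rev (Φb z')]; exact add_le_add (add_le_add hm hm') h3
      _ = 5 * ε := by ring
  -- `‖2w‖ < 1/3`
  have hμ : 0 < μ := by linarith
  have hw2 : ‖(2 : ℝ) • w‖ < 1 / 3 := by
    rw [norm_smul, Real.norm_two]
    have h1 : μ * ‖w‖ ≤ 5 * ε := (hΦb w).trans hΦw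
    by_contra hge
    push Not at hge
    nlinarith
  -- `⟪2w, U e⟫ ∈ (2/3)ℤ` for the origin shell
  have hσ := cast_letter_eq ht 0
  have hτ := neg_cast_letter_eq ht (0 - 1)
  have hint : ∀ e ∈ layerShell (t 0 : ℝ) (-((t (0 - 1) : ℤ) : ℝ)), ∃ n : ℤ, ⟪(2 : ℝ) • w, U e⟫ = 2 / 3 * n := by
    intro e he
    have he' : (2 : ℝ)⁻¹ • e ∈ barlowShell (t 0 : ℝ) (-((t (0 - 1) : ℤ) : ℝ)) := ⟨e, he, rfl⟩
    have hUe : U e = (2 : ℝ) • U ((2 : ℝ)⁻¹ • e) := by rw [← map_smul, smul_inv_smul₀ two_ne_zero]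
    obtain ⟨n₁, hn₁⟩ := inner_two_smul_sub_basedImage_mem hp₀ hz hz' (hU _ he')
    obtain ⟨n₂, hn₂⟩ := (isFrameInt_two_smul_sub hx hx').inner_mem (isFrameInt_of_mem_layerShell hσ hτ he)
    refine ⟨n₁ - n₂, ?_⟩
    have e1 : ⟪(2 : ℝ) • w, U e⟫ = ⟪(2 : ℝ) • (z - z'), (2 : ℝ) • U ((2 : ℝ)⁻¹ • e)⟫ - ⟪(2 : ℝ) • (x - x'), e⟫ := by
      rw [hw, smul_sub, inner_sub_left, ← hUe, ← map_smul, U.inner_map_map]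
    rw [e1, hn₁, hn₂]; push_cast; ring
  have h0 : (2 : ℝ) • w = 0 := eq_zero_of_inner_shell_mem hσ hτ U hint hw2
  have hw0 : w = 0 := by
    rcases smul_eq_zero.mp h0 with h | h
    · norm_num at h
    · exact h
  rw [hw] at hw0
  exact sub_eq_zero.mp hw0

/-! ## §3  Identification by minimal counterexample (PROVED) -/

/-- A `δ`-separated subset (`δ > 0`) of a closed ball of `ℝ³` is finite (an infinite subset of the compact ball has an accumulation point,
near which two points of the set are closer than `δ`). [folklore; cf. Literature `LocalMatchingCompactness`] -/
theorem finite_of_separated_of_subset_closedBall {S : Set (EuclideanSpace ℝ (Fin 3))} {δ : ℝ} (hδ : 0 < δ)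
    (hsep : ∀ p ∈ S, ∀ q ∈ S, p ≠ q → δ ≤ dist p q) {c : EuclideanSpace ℝ (Fin 3)} {R : ℝ} (hS : S ⊆ Metric.closedBall c R) :
    S.Finite := by
  by_contra hinf
  obtain ⟨a, -, ha⟩ := Set.Infinite.exists_accPt_of_subset_isCompact hinf (isCompact_closedBall c R) hS
  rw [accPt_iff_nhds] at ha
  obtain ⟨y₁, ⟨hy₁U, hy₁S⟩, hy₁a⟩ := ha (Metric.ball a (δ / 2)) (Metric.ball_mem_nhds a (half_pos hδ))
  have hr : 0 < dist y₁ a := dist_pos.2 hy₁a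
  obtain ⟨y₂, ⟨hy₂U, hy₂S⟩, -⟩ := ha (Metric.ball a (dist y₁ a)) (Metric.ball_mem_nhds a hr)
  rw [Metric.mem_ball] at hy₁U hy₂U
  have hne : y₁ ≠ y₂ := fun h => by rw [h] at hy₂U; exact lt_irrefl _ hy₂U
  have h1 := hsep y₁ hy₁S y₂ hy₂S hne
  have : dist y₁ y₂ < δ :=
    calc dist y₁ y₂ ≤ dist y₁ a + dist y₂ a := dist_triangle_right _ _ _
      _ < δ / 2 + δ / 2 := add_lt_add hy₁U (hy₂U.trans hy₁U)
      _ = δ := by ring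
  linarith

/-- The window `{x ∈ 𝓛(t) : dist x 0 ≤ R}` is finite (the stacking is `min 1 √(2/3)`-separated). [this file] -/
theorem finite_window (t : ℤ → ℤ) (R : ℝ) :
    {p | p ∈ barlowStacking 1 (Real.sqrt (2 / 3)) t ∧ dist p 0 ≤ R}.Finite := by
  refine finite_of_separated_of_subset_closedBall (δ := min 1 (Real.sqrt (2 / 3))) (lt_min one_pos (by positivity))
    (fun p hp q hq hpq => le_dist_of_mem_barlowStacking 1 (Real.sqrt (2 / 3)) t zero_le_one (Real.sqrt_nonneg _) hp.1 hq.1 hpq)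
    (c := 0) (R := R) ?_
  intro p hp
  exact Metric.mem_closedBall.2 hp.2

/-- **IDENTIFICATION BY MINIMAL COUNTEREXAMPLE (PROVED).**  Setting of the file docstring with `Φ_c = a • B`,
`(22/25)‖v‖ ≤ ‖B v‖ ≤ (28/25)‖v‖`, `μ‖v‖ ≤ ‖Φ_b v‖`, `0 ≤ ε`, `30ε < μ`, `U` a linear isometry carrying the origin shell of `𝓛(t)` into `Z`
with `‖Φ_c v − Φ_b(U v)‖ ≤ 3ε‖v‖`.  If every `x ∈ 𝓛(t)` with `‖Φ_c x‖ ≤ ρ` is matched to some `z ∈ Z`, then EVERY matched pair `(x, z)`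
with `‖Φ_c x‖ ≤ ρ` has `z = U x`.  (A counterexample minimal in `‖B x‖` is `≠ 0` by separation of `Z`; its inward contact neighbour —
`0` if `‖x‖ = 1`, else `x + e` from C1 §4 — is matched and identified, and the step lemma gives `z = U x`.) [this file] -/
theorem eq_of_matched {t s : ℤ → ℤ} (ht : IsHaggSeq t) (hs : IsHaggSeq s) {p₀ : EuclideanSpace ℝ (Fin 3)}
    (hp₀ : p₀ ∈ barlowStacking 1 (Real.sqrt (2 / 3)) s) {V : EuclideanSpace ℝ (Fin 3) →ₗᵢ[ℝ] EuclideanSpace ℝ (Fin 3)}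
    {B Φb : EuclideanSpace ℝ (Fin 3) →ₗ[ℝ] EuclideanSpace ℝ (Fin 3)} {a μ ε ρ : ℝ} (ha : 0 < a)
    (hlo : ∀ v, 22 / 25 * ‖v‖ ≤ ‖B v‖) (hhi : ∀ v, ‖B v‖ ≤ 28 / 25 * ‖v‖) (hΦb : ∀ v, μ * ‖v‖ ≤ ‖Φb v‖) (hε0 : 0 ≤ ε)
    (hε : 30 * ε < μ) (U : EuclideanSpace ℝ (Fin 3) →ₗᵢ[ℝ] EuclideanSpace ℝ (Fin 3))
    (hD : ∀ v, ‖(a • B) v - Φb (U v)‖ ≤ 3 * ε * ‖v‖)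
    (hU : ∀ e ∈ barlowShell (t 0 : ℝ) (-((t (0 - 1) : ℤ) : ℝ)), U e ∈ basedImage V s p₀)
    (hM : ∀ x ∈ barlowStacking 1 (Real.sqrt (2 / 3)) t, ‖(a • B) x‖ ≤ ρ → ∃ z ∈ basedImage V s p₀, ‖(a • B) x - Φb z‖ ≤ ε) :
    ∀ x ∈ barlowStacking 1 (Real.sqrt (2 / 3)) t, ‖(a • B) x‖ ≤ ρ →
      ∀ z ∈ basedImage V s p₀, ‖(a • B) x - Φb z‖ ≤ ε → z = U x := by
  have hμ : 0 < μ := by linarith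
  have nsm : ∀ v, ‖(a • B) v‖ = a * ‖B v‖ := fun v => by
    rw [LinearMap.smul_apply, norm_smul, Real.norm_eq_abs, abs_of_pos ha]
  by_contra H
  push Not at H
  -- the finite nonempty set of counterexamples
  set S : Set (EuclideanSpace ℝ (Fin 3)) := {x | x ∈ barlowStacking 1 (Real.sqrt (2 / 3)) t ∧ ‖(a • B) x‖ ≤ ρ ∧
    ∃ z ∈ basedImage V s p₀, ‖(a • B) x - Φb z‖ ≤ ε ∧ z ≠ U x} with hS
  have hne : S.Nonempty := by
    obtain ⟨x, hx, hρx, z, hz, hm, hzne⟩ := H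
    exact ⟨x, hx, hρx, z, hz, hm, hzne⟩
  have hfin : S.Finite := by
    refine (finite_window t (ρ / (a * (22 / 25)))).subset ?_
    rintro x ⟨hx, hρx, -⟩
    refine ⟨hx, ?_⟩
    rw [dist_zero_right, le_div_iff₀ (by positivity)]
    have := hlo x
    rw [nsm] at hρx
    nlinarith
  obtain ⟨x₀, ⟨hx₀, hρ₀, z₀, hz₀, hm₀, hne₀⟩, hmin⟩ := Set.exists_min_image S (fun x => ‖B x‖) hfin hne
  apply hne₀
  -- `x₀ ≠ 0`
  have hx₀0 : x₀ ≠ 0 := by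
    rintro rfl
    apply hne₀
    rw [map_zero]
    refine basedImage_eq_of_dist_lt_one hs hz₀ (zero_mem_basedImage V hp₀) ?_
    rw [dist_zero_right]
    have h1 : ‖Φb z₀‖ ≤ ε := by rw [map_zero, zero_sub, norm_neg] at hm₀; exact hm₀
    have h2 : μ * ‖z₀‖ ≤ ε := (hΦb z₀).trans h1
    by_contra hge
    push Not at hge
    nlinarith
  -- an inward neighbour `x₁`
  obtain ⟨x₁, hx₁, hd₁, hlt₁⟩ : ∃ x₁ ∈ barlowStacking 1 (Real.sqrt (2 / 3)) t, ‖x₀ - x₁‖ ≤ 1 ∧ ‖B x₁‖ < ‖B x₀‖ := by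
    rcases norm_eq_one_or_sqrt_two_le ht hx₀ hx₀0 with h1 | h2
    · refine ⟨0, zero_mem_barlowStacking t, by rw [sub_zero, h1], ?_⟩
      rw [map_zero, norm_zero]
      have := hlo x₀
      rw [h1] at this
      linarith
    · have hsq : 2 ≤ ‖x₀‖ ^ 2 := by
        have h0 : (0 : ℝ) ≤ Real.sqrt 2 := Real.sqrt_nonneg _
        have := Real.sq_sqrt (show (0 : ℝ) ≤ 2 by norm_num)
        nlinarith [h2, h0]
      obtain ⟨k, i, j, hq⟩ := hx₀
      have hσ := cast_letter_eq ht k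
      have hτ := neg_cast_letter_eq ht (k - 1)
      obtain ⟨e, he, hlt⟩ := exists_barlowShell_norm_map_add_lt hσ hτ B hlo hhi hsq
      refine ⟨x₀ + e, ?_, ?_, hlt⟩
      · rw [hq]; exact barlowPos_add_mem_of_mem_barlowShell ht k i j he
      · rw [sub_add_cancel_left, norm_neg, norm_eq_one_of_mem_barlowShell hσ hτ he]
  -- `x₁` is matched, and identified by minimality
  have hρ₁ : ‖(a • B) x₁‖ ≤ ρ := by
    rw [nsm] at hρ₀ ⊢
    nlinarith
  obtain ⟨z₁, hz₁, hm₁⟩ := hM x₁ hx₁ hρ₁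
  have hid₁ : z₁ = U x₁ := by
    by_contra hne₁
    have hS₁ : x₁ ∈ S := ⟨hx₁, hρ₁, z₁, hz₁, hm₁, hne₁⟩
    exact absurd (hmin x₁ hS₁) (not_le.2 hlt₁)
  -- the step lemma transfers the identification to `x₀`
  have hstep := step_eq ht hp₀ hΦb hε U hD hU hx₀ hx₁ hz₀ hz₁ hm₀ hm₁ hd₁
  rw [hid₁, map_sub] at hstep
  have : z₀ = U x₀ := by
    have h := sub_eq_iff_eq_add.mp hstep
    rw [h]; abel
  exact this

end Summit.AtomisticToContinuum.Crystallization.Theorems.OverbindingBudgetAffineFarSmoothSplit
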